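import Literature.Computability.AlgebraicComplexity.LMR13DualSchemeDetProofs
import Literature.Computability.AlgebraicComplexity.OrbitClosureIrreducible
import Literature.Computability.AlgebraicComplexity.OrbitClosureProofs
import HarnessLib

/-!
# Landsberg–Manivel–Ressayre 2013, §3.3–§3.4: the orbit tangent space `𝔤𝔩(W)·P` lies in the Zariski
# tangent space of `𝒟ual_{k,d,N}` at `P` whenever `End(W)·P ⊆ 𝒟ual_{k,d,N}`; for `det_n` (PROVED)

Sixth proofs sibling of `Literature/Computability/AlgebraicComplexity/LMR13DualVarieties.lean` (cell
`val-lit`, typer `val-lit-t11`). Honest framing: typed literature; VP ≠ VNP is NOT proved and nothing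
here is progress on it.

LMR 2013 prove (Thm. 3.1.1, via §3.3–§3.4, journal pp. 477–480) that the affine Zariski tangent space
`T̂_{[det_n]} 𝒟ual_{2n−2,n,n²}` EQUALS the tangent space `𝔤𝔩_{n²}·det_n` of the orbit ("the scheme is
smooth at `[det_n]`"); the inclusion `⊇` is the formal one (the orbit lies in the scheme). This file
PROVES that inclusion in the typed vocabulary (`lmrZariskiTangent`, `glTangent`, `firstOrderDeformation`):

* `coeff_one_aeval_C_mul_X` and `lmrTangentForm_linear` — the `ε`-coefficient of
  `E_{B,u,v}(P + επ)` is `ℂ`-linear in `π` (base change of the equation to `ℂ[ε₀, ε₁]`,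
  `map_lmrDualEquation`), so `lmrZariskiTangent k d P` is closed under `0`, `+`, scalars;
* `linSubst_one_add_single_taylor` — first-order Taylor expansion of the transvection curve
  `x_a ↦ x_a + ε x_b`: `(1 + ε E_{ba})·P = P + ε·x_b ∂_a P + ε²·τ`;
* `X_mul_pderiv_mem_lmrZariskiTangent` — if `End(W)·P ⊆ 𝒟ual_{k,d,N}` then every `x_b ∂_a P` lies in
  `T̂_P 𝒟ual_{k,d,N}`: `E(curve) ∈ ℂ[ε]` vanishes at every `ε = t ∈ ℂ` (the curve stays in `End·P`),
  hence is `0`; reducing modulo `ε²` (`ℂ[ε] → ℂ[ε]/(ε²)`, base change again) identifies its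
  `ε`-coefficient with that of `E(P + ε x_b∂_aP)`;
* `glTangent_subset_lmrZariskiTangent_of_endOrbit_subset`, and for the determinant (`n ≥ 3`, using
  `\overline{GL·det_n} ⊆ 𝒟ual_{2n−2,n,n²}` from `LMR13DualSchemeDetProofs.lean` and
  `End·det_n ⊆ \overline{GL·det_n}`): **`𝔤𝔩_{n²}·det_n ⊆ T̂_{[det_n]} 𝒟ual_{2n−2,n,n²}`**
  (`glTangent_detPoly_subset_lmrZariskiTangent`) — the `⊇` half of the tangent clause of
  `LMR2013_thm_3_1_1`; the `⊆` half (Lemmas 3.3.1–3.4.1, the character computation) stays in the fact;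
* `LMR2013_thm_3_1_1_iff` — bookkeeping: the named fact is equivalent to (tangent `⊆`) ∧ (maximality of
  `Δ[det_n]` among irreducible subsets of `𝒟ual`), the other three sub-claims being proved here and in
  `LMR13DualSchemeDetProofs.lean` / `OrbitClosureIrreducible.lean`.

## References

* [LandsbergManivelRessayre2013] Comment. Math. Helv. 88 (2013) 469–484, §3.3 ("consider a curve
  `P_ε = P + επ + ε²τ`", p. 477), §3.4 and Thm. 3.1.1 (pp. 479–480).
-/

noncomputable section

open MvPolynomial

namespace Literature.Computability.AlgebraicComplexity

open _root_.Literature.NumberTheory.DiophantineGeometry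

/-! ### The `ε`-coefficient of `E(P + επ)` is linear in `π` -/

section Linear

/-- Coefficient bookkeeping in `ℂ[ε₀, ε₁] → ℂ[ε]`, `εᵢ ↦ aᵢ ε`: the `ε`-coefficient of the image of
`W` is `a₀ [ε₀]W + a₁ [ε₁]W`. [cite: LandsbergManivelRessayre2013, §3.3 (p. 477)] -/
theorem coeff_one_aeval_C_mul_X (W : MvPolynomial (Fin 2) ℂ) (a₀ a₁ : ℂ) :
    (aeval ![Polynomial.C a₀ * Polynomial.X, Polynomial.C a₁ * Polynomial.X] W).coeff 1 =
      a₀ * coeff (Finsupp.single 0 1) W + a₁ * coeff (Finsupp.single 1 1) W := by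
  classical
  induction W using MvPolynomial.induction_on' with
  | monomial m c =>
    rw [aeval_monomial, Finsupp.prod_fintype _ _ (fun i => by simp), Fin.prod_univ_two,
      coeff_monomial, coeff_monomial]
    simp only [Matrix.cons_val_zero, Matrix.cons_val_one]
    rw [mul_pow, mul_pow, ← map_pow, ← map_pow,
      show algebraMap ℂ (Polynomial ℂ) c * (Polynomial.C (a₀ ^ m 0) * Polynomial.X ^ m 0 *
          (Polynomial.C (a₁ ^ m 1) * Polynomial.X ^ m 1)) =
        Polynomial.C (c * a₀ ^ m 0 * a₁ ^ m 1) * Polynomial.X ^ (m 0 + m 1) by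
        rw [Polynomial.algebraMap_eq, map_mul, map_mul, pow_add]; ring,
      Polynomial.coeff_C_mul_X_pow]
    have key : ∀ m' : Fin 2 →₀ ℕ, m = m' ↔ m 0 = m' 0 ∧ m 1 = m' 1 := fun m' =>
      ⟨fun h => by subst h; exact ⟨rfl, rfl⟩, fun h => Finsupp.ext fun i => by
        fin_cases i <;> simp [h.1, h.2]⟩
    simp only [key, Finsupp.single_eq_same, Finsupp.single_eq_of_ne (show (0 : Fin 2) ≠ 1 by decide),
      Finsupp.single_eq_of_ne (show (1 : Fin 2) ≠ 0 by decide)]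
    by_cases h2 : m 0 = 1 ∧ m 1 = 0
    · rw [if_pos (show 1 = m 0 + m 1 by omega), if_pos h2,
        if_neg (show ¬(m 0 = 0 ∧ m 1 = 1) by omega), h2.1, h2.2]
      ring
    · by_cases h3 : m 0 = 0 ∧ m 1 = 1
      · rw [if_pos (show 1 = m 0 + m 1 by omega), if_neg h2, if_pos h3, h3.1, h3.2]
        ring
      · rw [if_neg (show ¬(1 = m 0 + m 1) by omega), if_neg h2, if_neg h3]
        ring
  | add p q hp hq =>
    rw [map_add, Polynomial.coeff_add, hp, hq, coeff_add, coeff_add]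
    ring

variable {σ : Type*} [Fintype σ]

/-- **The differential of the equations is linear**: for fixed `P` and data `(B,u,v)`, the
`ε`-coefficient `π ↦ [ε] E_{B,u,v}(P + επ)` satisfies
`[ε]E(P + ε(a₀π₁ + a₁π₂)) = a₀ [ε]E(P + επ₁) + a₁ [ε]E(P + επ₂)` — base change of `E` along
`ℂ[ε₀,ε₁] → ℂ[ε]` applied to `P + ε₀π₁ + ε₁π₂` (LMR §3.3, "consider a curve `P_ε = P + επ + …`";
the Zariski tangent space is a linear space). [cite: LandsbergManivelRessayre2013, §3.3 (p. 477)] -/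
theorem lmrTangentForm_linear (κ d : ℕ) (B : Matrix (Fin (κ + 3)) σ ℂ) (u v : σ → ℂ)
    (P π₁ π₂ : MvPolynomial σ ℂ) (a₀ a₁ : ℂ) :
    (lmrDualEquation κ d (B.map (Polynomial.C : ℂ →+* Polynomial ℂ))
        (fun i => Polynomial.C (u i)) (fun i => Polynomial.C (v i))
        (firstOrderDeformation P (a₀ • π₁ + a₁ • π₂))).coeff 1 =
      a₀ * (lmrDualEquation κ d (B.map (Polynomial.C : ℂ →+* Polynomial ℂ))
        (fun i => Polynomial.C (u i)) (fun i => Polynomial.C (v i))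
        (firstOrderDeformation P π₁)).coeff 1 +
      a₁ * (lmrDualEquation κ d (B.map (Polynomial.C : ℂ →+* Polynomial ℂ))
        (fun i => Polynomial.C (u i)) (fun i => Polynomial.C (v i))
        (firstOrderDeformation P π₂)).coeff 1 := by
  classical
  -- the two-parameter deformation `Q = P + ε₀π₁ + ε₁π₂` over `ℂ[ε₀, ε₁]` and its equation `W`
  obtain ⟨Q, hQ⟩ : ∃ Q : MvPolynomial σ (MvPolynomial (Fin 2) ℂ),
      Q = map (C : ℂ →+* MvPolynomial (Fin 2) ℂ) P +
        C (X 0 : MvPolynomial (Fin 2) ℂ) * map (C : ℂ →+* MvPolynomial (Fin 2) ℂ) π₁ +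
        C (X 1 : MvPolynomial (Fin 2) ℂ) * map (C : ℂ →+* MvPolynomial (Fin 2) ℂ) π₂ := ⟨_, rfl⟩
  obtain ⟨W, hW⟩ : ∃ W : MvPolynomial (Fin 2) ℂ,
      W = lmrDualEquation κ d (B.map (C : ℂ →+* MvPolynomial (Fin 2) ℂ)) (fun i => C (u i))
        (fun i => C (v i)) Q := ⟨_, rfl⟩
  -- specialisation `εᵢ ↦ bᵢ ε`
  have hspec : ∀ b₀ b₁ : ℂ,
      ((aeval ![Polynomial.C b₀ * Polynomial.X, Polynomial.C b₁ * Polynomial.X] :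
          MvPolynomial (Fin 2) ℂ →ₐ[ℂ] Polynomial ℂ) : MvPolynomial (Fin 2) ℂ →+* Polynomial ℂ) W =
        lmrDualEquation κ d (B.map (Polynomial.C : ℂ →+* Polynomial ℂ))
          (fun i => Polynomial.C (u i)) (fun i => Polynomial.C (v i))
          (firstOrderDeformation P (b₀ • π₁ + b₁ • π₂)) := by
    intro b₀ b₁
    obtain ⟨ψ, hψ⟩ : ∃ ψ : MvPolynomial (Fin 2) ℂ →+* Polynomial ℂ,
        ψ = ((aeval ![Polynomial.C b₀ * Polynomial.X, Polynomial.C b₁ * Polynomial.X] :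
          MvPolynomial (Fin 2) ℂ →ₐ[ℂ] Polynomial ℂ) : MvPolynomial (Fin 2) ℂ →+* Polynomial ℂ) :=
      ⟨_, rfl⟩
    have hψC : ∀ c : ℂ, ψ (C c) = Polynomial.C c := fun c => by
      rw [hψ, RingHom.coe_coe, aeval_C, Polynomial.algebraMap_eq]
    have hψ0 : ψ (X 0) = Polynomial.C b₀ * Polynomial.X := by
      rw [hψ, RingHom.coe_coe, aeval_X, Matrix.cons_val_zero]
    have hψ1 : ψ (X 1) = Polynomial.C b₁ * Polynomial.X := by
      rw [hψ, RingHom.coe_coe, aeval_X, Matrix.cons_val_one, Matrix.cons_val_zero]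
    have hψC' : ψ.comp (C : ℂ →+* MvPolynomial (Fin 2) ℂ) = Polynomial.C :=
      RingHom.ext fun c => hψC c
    have hB : (B.map (C : ℂ →+* MvPolynomial (Fin 2) ℂ)).map ψ =
        B.map (Polynomial.C : ℂ →+* Polynomial ℂ) := by
      ext i j
      rw [Matrix.map_map, Matrix.map_apply, Matrix.map_apply, Function.comp_apply, hψC]
    have hu : (fun i => ψ (C (u i))) = fun i => Polynomial.C (u i) := funext fun i => hψC (u i)
    have hv : (fun i => ψ (C (v i))) = fun i => Polynomial.C (v i) := funext fun i => hψC (v i)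
    have hQ' : map ψ Q = firstOrderDeformation P (b₀ • π₁ + b₁ • π₂) := by
      rw [hQ, firstOrderDeformation]
      simp only [map_add, map_mul, map_C, MvPolynomial.map_map, hψC', hψ0, hψ1, smul_eq_C_mul]
      ring
    rw [← hψ, hW, map_lmrDualEquation, hB, hu, hv, hQ']
  have h11 := hspec a₀ a₁
  have h10 := hspec 1 0
  have h01 := hspec 0 1
  simp only [one_smul, zero_smul, add_zero, zero_add] at h10 h01
  rw [← h11, ← h10, ← h01]
  simp only [RingHom.coe_coe, coeff_one_aeval_C_mul_X]
  ring

/-- `0 ∈ T̂_P`: `E(P + ε·0) = E(P)` is constant in `ε`. [cite: LandsbergManivelRessayre2013, §3.3 (p. 477)] -/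
theorem zero_mem_lmrZariskiTangent (κ d : ℕ) (P : MvPolynomial σ ℂ) :
    (0 : MvPolynomial σ ℂ) ∈ lmrZariskiTangent κ d P := by
  classical
  refine ⟨isHomogeneous_zero σ ℂ d, fun B u v => ?_⟩
  rw [firstOrderDeformation, map_zero, mul_zero, add_zero, ← map_lmrDualEquation,
    Polynomial.coeff_C, if_neg one_ne_zero]

/-- `T̂_P` is closed under linear combinations. [cite: LandsbergManivelRessayre2013, §3.3 (p. 477)] -/
theorem smul_add_smul_mem_lmrZariskiTangent {κ d : ℕ} {P π₁ π₂ : MvPolynomial σ ℂ}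
    (h₁ : π₁ ∈ lmrZariskiTangent κ d P) (h₂ : π₂ ∈ lmrZariskiTangent κ d P) (a₀ a₁ : ℂ) :
    a₀ • π₁ + a₁ • π₂ ∈ lmrZariskiTangent κ d P := by
  classical
  refine ⟨((homogeneousSubmodule σ ℂ d).smul_mem a₀ h₁.1).add
    ((homogeneousSubmodule σ ℂ d).smul_mem a₁ h₂.1), fun B u v => ?_⟩
  rw [lmrTangentForm_linear, h₁.2 B u v, h₂.2 B u v, mul_zero, mul_zero, add_zero]

end Linear

/-! ### First-order Taylor expansion of a transvection curve -/

section Taylor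

variable {R : Type*} [CommRing R] {σ : Type*} [Fintype σ] [DecidableEq σ]

/-- The transvection curve `1 + ε E_{ba}` substitutes `x_a ↦ x_a + ε x_b` and fixes the other
variables. [cite: LandsbergManivelRessayre2013, §3.4 (p. 479)] -/
theorem linSubst_one_add_single_X (a b i : σ) :
    linSubst σ (Polynomial R) (1 + Matrix.single b a Polynomial.X) (X i) =
      X i + if i = a then C Polynomial.X * X b else 0 := by
  rw [linSubst_X]
  simp only [Matrix.add_apply, Matrix.one_apply, Matrix.single_apply, add_smul, ite_smul, one_smul,
    zero_smul, Finset.sum_add_distrib, Finset.sum_ite_eq', Finset.mem_univ, if_true, smul_eq_C_mul]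
  congr 1
  by_cases hi : i = a
  · subst hi
    rw [if_pos rfl]
    rw [Finset.sum_eq_single b]
    · rw [if_pos ⟨rfl, rfl⟩]
    · intro j _ hj
      rw [if_neg (fun h => hj h.1.symm)]
    · intro h
      exact absurd (Finset.mem_univ b) h
  · rw [if_neg hi]
    exact Finset.sum_eq_zero fun j _ => if_neg fun h => hi h.2.symm

/-- **First-order Taylor expansion along a transvection** (LMR §3.3: "a curve `P_ε = P + επ + ε²τ`";
§3.4: the tangent space of the orbit is spanned by the `x_b ∂_a P`): over `R[ε]`,
`(1 + ε E_{ba})·P = P + ε·(x_b ∂_a P) + ε²·τ` for some `τ`. [cite: LandsbergManivelRessayre2013, §3.3–§3.4 (pp. 477–479)] -/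
theorem linSubst_one_add_single_taylor (a b : σ) (P : MvPolynomial σ R) :
    ∃ τ : MvPolynomial σ (Polynomial R),
      linSubst σ (Polynomial R) (1 + Matrix.single b a Polynomial.X) (map Polynomial.C P) =
        map Polynomial.C P + C Polynomial.X * map Polynomial.C (X b * pderiv a P) +
          C (Polynomial.X ^ 2) * τ := by
  induction P using MvPolynomial.induction_on with
  | C c =>
    refine ⟨0, ?_⟩
    rw [map_C, pderiv_C, mul_zero, map_zero, mul_zero, mul_zero, add_zero, add_zero]
    exact aeval_C _ _
  | add p q hp hq =>
    obtain ⟨τ₁, h₁⟩ := hp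
    obtain ⟨τ₂, h₂⟩ := hq
    refine ⟨τ₁ + τ₂, ?_⟩
    rw [map_add, map_add, h₁, h₂]
    simp only [map_add, mul_add]
    ring
  | mul_X p i hp =>
    obtain ⟨τ, h⟩ := hp
    rw [map_mul, map_X, map_mul, h, linSubst_one_add_single_X, pderiv_mul, pderiv_X]
    by_cases hi : i = a
    · subst hi
      refine ⟨map Polynomial.C (X b * pderiv i p) * X b + τ * X i + C Polynomial.X * τ * X b, ?_⟩
      rw [if_pos rfl, Pi.single_eq_same, mul_one]
      simp only [map_mul, map_add, map_X, map_pow]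
      ring
    · refine ⟨τ * X i, ?_⟩
      rw [if_neg hi, Pi.single_eq_of_ne hi, mul_zero, add_zero, add_zero]
      simp only [map_mul, map_X, map_pow]
      ring

end Taylor

/-! ### Orbit directions are Zariski tangent vectors -/

section Tangent

variable {σ : Type*} [Fintype σ] [DecidableEq σ]

/-- **Orbit tangent directions lie in the Zariski tangent space** (LMR §3.3–§3.4, pp. 477–479): if
the whole endomorphism orbit `End(W)·P` lies in `𝒟ual_{k,d,N}`, then for all `a, b` the form
`x_b ∂_a P ∈ 𝔤𝔩(W)·P` belongs to `T̂_P 𝒟ual_{k,d,N}` (`lmrZariskiTangent`). Proof: along the curve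
`P_ε = (1 + εE_{ba})·P` the equation `E_{B,u,v}(P_ε) ∈ ℂ[ε]` vanishes at every `ε = t ∈ ℂ`
(`P_t ∈ End·P`), hence is zero (`Polynomial.funext`); modulo `ε²`, `P_ε ≡ P + ε x_b∂_aP`
(`linSubst_one_add_single_taylor`), and `E` commutes with `ℂ[ε] → ℂ[ε]/(ε²)`
(`map_lmrDualEquation`), so `ε² ∣ E(P + ε x_b∂_aP)`. [cite: LandsbergManivelRessayre2013, §3.3–§3.4 (pp. 477–479)] -/
theorem X_mul_pderiv_mem_lmrZariskiTangent {κ d : ℕ} {P : MvPolynomial σ ℂ} (hP : P.IsHomogeneous d)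
    (hEnd : endOrbit σ ℂ P ⊆ lmrDualScheme κ d) (a b : σ) :
    X b * pderiv a P ∈ lmrZariskiTangent κ d P := by
  classical
  -- degree-0 forms: the direction is `0`
  rcases Nat.eq_zero_or_pos d with rfl | hd
  · have hP0 : pderiv a P = 0 := by
      rw [← totalDegree_zero_iff_isHomogeneous, totalDegree_eq_zero_iff_eq_C] at hP
      rw [hP, pderiv_C]
    rw [hP0, mul_zero]
    exact zero_mem_lmrZariskiTangent κ 0 P
  refine ⟨?_, fun B u v => ?_⟩
  · have := (isHomogeneous_X ℂ b).mul (hP.pderiv (i := a))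
    rwa [show 1 + (d - 1) = d by omega] at this
  -- the curve and its equation
  set M : Matrix σ σ (Polynomial ℂ) := 1 + Matrix.single b a Polynomial.X with hM
  set Pε : MvPolynomial σ (Polynomial ℂ) := linSubst σ (Polynomial ℂ) M (map Polynomial.C P) with hPε
  set Bε := B.map (Polynomial.C : ℂ →+* Polynomial ℂ) with hBε
  have hcurve : lmrDualEquation κ d Bε (fun i => Polynomial.C (u i)) (fun i => Polynomial.C (v i))
      Pε = 0 := by
    refine Polynomial.funext fun t => ?_
    rw [Polynomial.eval_zero, ← Polynomial.coe_evalRingHom, map_lmrDualEquation]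
    have hB : Bε.map (Polynomial.evalRingHom t) = B := by
      ext i j
      simp only [hBε, Matrix.map_apply, Polynomial.coe_evalRingHom, Polynomial.eval_C]
    have hu : (fun i => Polynomial.evalRingHom t (Polynomial.C (u i))) = u :=
      funext fun i => by rw [Polynomial.coe_evalRingHom, Polynomial.eval_C]
    have hv : (fun i => Polynomial.evalRingHom t (Polynomial.C (v i))) = v :=
      funext fun i => by rw [Polynomial.coe_evalRingHom, Polynomial.eval_C]
    have hPt : map (Polynomial.evalRingHom t) Pε =
        linSubst σ ℂ (M.map (Polynomial.evalRingHom t)) P := by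
      rw [hPε, map_linSubst, MvPolynomial.map_map]
      congr 1
      have : (Polynomial.evalRingHom t).comp (Polynomial.C : ℂ →+* Polynomial ℂ) = RingHom.id ℂ :=
        RingHom.ext fun c => by simp
      rw [this, map_id]
    rw [hB, hu, hv, hPt]
    exact (hEnd ⟨M.map (Polynomial.evalRingHom t), rfl⟩).2 B u v
  -- reduce modulo `ε²`
  obtain ⟨τ, hτ⟩ := linSubst_one_add_single_taylor (R := ℂ) a b P
  set I : Ideal (Polynomial ℂ) := Ideal.span {Polynomial.X ^ 2} with hI
  set φ : Polynomial ℂ →+* Polynomial ℂ ⧸ I := Ideal.Quotient.mk I with hφ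
  have hφX2 : φ (Polynomial.X ^ 2) = 0 :=
    Ideal.Quotient.eq_zero_iff_mem.mpr (Ideal.subset_span rfl)
  have hred : map φ Pε = map φ (firstOrderDeformation P (X b * pderiv a P)) := by
    rw [hPε, hM, hτ, firstOrderDeformation]
    simp only [map_add, map_mul, map_C, hφX2, C_0, zero_mul, add_zero]
  have hmem : lmrDualEquation κ d Bε (fun i => Polynomial.C (u i)) (fun i => Polynomial.C (v i))
      (firstOrderDeformation P (X b * pderiv a P)) ∈ I := by
    rw [← Ideal.Quotient.eq_zero_iff_mem, ← hφ, map_lmrDualEquation, ← hred, ← map_lmrDualEquation,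
      hcurve, map_zero]
  rw [hI, Ideal.mem_span_singleton] at hmem
  obtain ⟨r, hr⟩ := hmem
  rw [hr, Polynomial.coeff_X_pow_mul', if_neg (by omega)]

/-- **`𝔤𝔩(W)·P ⊆ T̂_P 𝒟ual_{k,d,N}` whenever `End(W)·P ⊆ 𝒟ual_{k,d,N}`** (the span of the
`x_b ∂_a P`, `glTangent`, lies in `lmrZariskiTangent`; linearity by `lmrTangentForm_linear`).
[cite: LandsbergManivelRessayre2013, §3.4 (p. 479)] -/
theorem glTangent_subset_lmrZariskiTangent_of_endOrbit_subset {κ d : ℕ} {P : MvPolynomial σ ℂ}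
    (hP : P.IsHomogeneous d) (hEnd : endOrbit σ ℂ P ⊆ lmrDualScheme κ d) :
    (glTangent P : Set (MvPolynomial σ ℂ)) ⊆ lmrZariskiTangent κ d P := by
  intro π hπ
  refine Submodule.span_induction (p := fun π _ => π ∈ lmrZariskiTangent κ d P) ?_ ?_ ?_ ?_ hπ
  · rintro _ ⟨a, b, rfl⟩
    exact X_mul_pderiv_mem_lmrZariskiTangent hP hEnd a b
  · exact zero_mem_lmrZariskiTangent κ d P
  · intro x y _ _ hx hy
    simpa using smul_add_smul_mem_lmrZariskiTangent hx hy 1 1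
  · intro c x _ hx
    simpa using smul_add_smul_mem_lmrZariskiTangent hx (zero_mem_lmrZariskiTangent κ d P) c 0

/-- **LMR 2013, Thm. 3.1.1, tangent clause, the inclusion `𝔤𝔩_{n²}·det_n ⊆ T̂_{[det_n]}𝒟ual_{2n−2,n,n²}`
— PROVED** (`n ≥ 3`): `End·det_n ⊆ \overline{GL·det_n} ⊆ 𝒟ual_{2n−2,n,n²}`
(`endOrbit_subset_orbitClosure_holds`, `orbitClosure_detPoly_subset_lmrDualScheme`) and
`glTangent_subset_lmrZariskiTangent_of_endOrbit_subset`. The reverse inclusion — the content of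
§3.3–§3.4 (Lemmas 3.3.1, 3.3.2, 3.4.1: `T̂ ⊆` the sum of the modules indexed by `P_n = {1ⁿ, 21^{n−2}}`,
which is `𝔤𝔩·det_n`) — remains in the named fact `LMR2013_thm_3_1_1`.
[cite: LandsbergManivelRessayre2013, Theorem 3.1.1 (p. 476, proof pp. 477–480)] -/
theorem glTangent_detPoly_subset_lmrZariskiTangent {n : ℕ} (hn : 3 ≤ n) :
    (glTangent (detPoly (Fin n) ℂ) : Set (MvPolynomial (Fin n × Fin n) ℂ)) ⊆
      lmrZariskiTangent (2 * n - 2) n (detPoly (Fin n) ℂ) := by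
  have hdet : (detPoly (Fin n) ℂ).IsHomogeneous n := by
    simpa only [Fintype.card_fin] using (detPoly_isHomogeneous : (detPoly (Fin n) ℂ).IsHomogeneous _)
  refine glTangent_subset_lmrZariskiTangent_of_endOrbit_subset hdet fun g hg =>
    orbitClosure_detPoly_subset_lmrDualScheme hn ?_
  exact endOrbit_subset_orbitClosure_holds _ hg

/-- In particular `det_n ∈ T̂_{[det_n]}𝒟ual_{2n−2,n,n²}` (Euler: `det_n = (1/n) Σ_a x_a ∂_a det_n ∈
𝔤𝔩·det_n`; here directly from the diagonal directions `x_a ∂_a det_n`). [cite: LandsbergManivelRessayre2013, §3.4 (p. 479)] -/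
theorem detPoly_mem_lmrZariskiTangent {n : ℕ} (hn : 3 ≤ n) :
    detPoly (Fin n) ℂ ∈ lmrZariskiTangent (2 * n - 2) n (detPoly (Fin n) ℂ) := by
  have hdet : (detPoly (Fin n) ℂ).IsHomogeneous n := by
    simpa only [Fintype.card_fin] using (detPoly_isHomogeneous : (detPoly (Fin n) ℂ).IsHomogeneous _)
  refine glTangent_detPoly_subset_lmrZariskiTangent hn ?_
  -- Euler's identity: `n • det_n = Σ_a x_a ∂_a det_n`
  have heuler := hdet.sum_X_mul_pderiv
  have hmem : ∑ a : Fin n × Fin n, X a * pderiv a (detPoly (Fin n) ℂ) ∈ glTangent (detPoly (Fin n) ℂ) :=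
    Submodule.sum_mem _ fun a _ => Submodule.subset_span ⟨a, a, rfl⟩
  rw [heuler] at hmem
  have hn0 : (n : ℂ) ≠ 0 := by exact_mod_cast (show n ≠ 0 by omega)
  have := Submodule.smul_mem _ ((n : ℂ)⁻¹) hmem
  rwa [← Nat.cast_smul_eq_nsmul ℂ, smul_smul, inv_mul_cancel₀ hn0, one_smul] at this

/-- **What remains of Thm. 3.1.1 after the proved parts.** With `𝔤𝔩·det_n ⊆ T̂`
(`glTangent_detPoly_subset_lmrZariskiTangent`), `Δ[det_n] ⊆ 𝒟ual` (`orbitClosure_detPoly_subset_lmrDualScheme`)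
and the irreducibility of `Δ[det_n]` (`orbitClosure_detPoly_isCoeffZariskiIrreducible`) PROVED, the named fact
`LMR2013_thm_3_1_1` is EQUIVALENT to the conjunction of its two printed contents: the inclusion
`T̂_{[det_n]}𝒟ual_{2n−2,n,n²} ⊆ 𝔤𝔩_{n²}·det_n` (LMR Lemmas 3.3.1, 3.3.2, 3.4.1: "`P_n = {1ⁿ, 21^{n−2}}`") and
the maximality of `Δ[det_n]` among the irreducible subsets of `𝒟ual_{2n−2,n,n²}` ("is an irreducible
component"). [cite: LandsbergManivelRessayre2013, Theorem 3.1.1 (p. 476, proof pp. 477–480)] -/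
theorem LMR2013_thm_3_1_1_iff :
    LMR2013_thm_3_1_1 ↔ ∀ n : ℕ, 3 ≤ n →
      lmrZariskiTangent (2 * n - 2) n (detPoly (Fin n) ℂ) ⊆ ↑(glTangent (detPoly (Fin n) ℂ)) ∧
      ∀ S' : Set (MvPolynomial (Fin n × Fin n) ℂ), IsCoeffZariskiIrreducible S' →
        orbitClosure (detPoly (Fin n) ℂ) ⊆ S' →
          S' ⊆ lmrDualScheme (σ := Fin n × Fin n) (2 * n - 2) n → S' ⊆ orbitClosure (detPoly (Fin n) ℂ) := by
  refine forall₂_congr fun n hn => ?_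
  rw [isCoeffIrreducibleComponent_iff_of_irreducible (orbitClosure_detPoly_subset_lmrDualScheme hn)
    (orbitClosure_detPoly_isCoeffZariskiIrreducible (by omega))]
  refine and_congr_left' ⟨fun h => h.le, fun h => ?_⟩
  exact Set.Subset.antisymm h (glTangent_detPoly_subset_lmrZariskiTangent hn)

end Tangent

end Literature.Computability.AlgebraicComplexity
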